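import Summits.MatrixMultiplication.MatrixMultiplication.Theorems.ConeTensorCore
import Summits.MatrixMultiplication.MatrixMultiplication.Theorems.TetrahedronTensorKronecker
import HarnessLib

/-!
# SesquiTensorCore — the sesqui-weighted tetrahedron `S_n = T(K₄)_n ⊠ W_n` (spokes `n³`, rim `n²`),
`T(K₄)_{n·n²} = ⟨n,n,n⟩_{rim} · S_n`, the covers `R₄(S_n) ≤ R₄(T(K₄)_n)·R₄(W_n)` and
`R₄(T(K₄)_{n·n²}) ≤ R(⟨n,n,n⟩)·R₄(S_n)`, the grouping `R(⟨n⁶,n⁴,n³⟩) ≤ R₄(S_n)` and the flattening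
`n¹⁰ ≤ R₄(S_n)`

(decomp-mm lens 6 «barrier-complement carving», gen 15; kernel of the node `SesquiCarving`, the
`u = s/r = 3/2` member of the SPOKE/RIM FAMILY of carvings of `ω = 2`: `u = 1` is the tetrahedron
carving `TetrahedronCarving` (gen 13, `ω = 2 ⟺ [ω(K₄) ≤ 4] ∧ [2ω ≤ ω(K₄)]`), `u = 2` the cone carving
(gen 14, `ω = 2 ⟺ [ω(W) ≤ 6] ∧ [3ω ≤ ω(W)]`, banked as asides of `TetrahedronCarving`). Companion
module `SesquiTensor`: the exponent `Ω = ω(S)`, the bracket `10 ≤ Ω ≤ min(5ω, ω(K₄) + ω(W))`,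
`3·ω(K₄) ≤ ω + Ω`, the exact cut `ω = 2 ⟺ [Ω ≤ 10] ∧ [5ω ≤ Ω]` and the comparison maps
`TetraNoSaving ⟹ SesquiNoSaving ⟹ ConeNoSaving`, `ConeFlat ⟹ SesquiFlat`.)

THE OBJECT. `S_n ∈ (F^{(n·n²)³})^{⊗4}` is the graph tensor (Christandl–Vrana–Zuiddam, arXiv:1609.07476
[CVZ19], Ex. 1.1.2) of the WEIGHTED tetrahedron with apex `0` whose spokes `01, 02, 03` carry EPR pairs
of size `n³` and whose rim edges `12, 13, 23` carry pairs of size `n²`; equivalently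
`S_n = T(K₄)_n ⊠ W_n`, the Kronecker product of the tetrahedron tensor at level `n` (all six edges
`n`) with the squared-spoke cone `W_n` (spokes `n²`, rim `n`) — which is how it is DEFINED here
(`sesqui`): with pair labels `Fin (n·n²) ≃ Fin n × Fin (n·n)` on every edge (the level-`n·n²` leg
format of `T(K₄)_{n·n²}`, first components re-encoded by `K₁`, second by `K₂`, as in
`tetra_mul_apply`), `S_n(i) = T(K₄)_n(K₁ ∘ i) · W_n(K₂ ∘ i)`. Since `T(K₄)_{n·n²}(i) =
T(K₄)_n(K₁ ∘ i) · T(K₄)_{n·n}(K₂ ∘ i)` (`tetra_mul_apply`) and `T(K₄)_{n·n} = ⟨n,n,n⟩_{rim} · W_n`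
(`tetra_sq_eq_rim_mul_cone`), the tetrahedron at level `n·n²` is the rim triangle times `S_n`
(`tetra_cube_eq_rim_mul_sesqui`).

What is proved here (every field, sorry-free): `sesqui_eq_sum_kron` / `tensorRankD_sesqui_le :
R₄(S_n) ≤ R₄(T(K₄)_n) · R₄(W_n)` (rank is sub-multiplicative under `⊠`, CVZ19 Prop. 1.1.16 (proof));
`sesqui_decomposable`, `tensorRankD_sesqui_le_pow_fifteen : R₄(S_n) ≤ n¹⁵`;
`tensorRankD_tetra_cube_le_mul_sesqui : R₄(T(K₄)_{n·n²}) ≤ R(⟨n,n,n⟩) · R₄(S_n)` (the rim cover);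
the Kronecker factorisation of matrix multiplication tensors `matMulTensor_fst₂_mul_snd₂ :
⟨k,m,p⟩ · ⟨k',m',p'⟩ = ⟨kk',mm',pp'⟩` on paired indices; the GROUPING `{2,3} | 0 | 1` (rim edge `23`
frozen): `tetra_tLabels` (the tetrahedron grouped this way is `⟨n², n², n⟩`), `sesqui_spoint` (the
grouped `S_n` is `⟨n²·n⁴, n²·n², n·n²⟩ = ⟨n⁶, n⁴, n³⟩`) and
`tensorRank_matMulTensor_le_tensorRankD_sesqui : R(⟨n⁶,n⁴,n³⟩) ≤ R₄(S_n)`; and from the tree's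
flattening bound `km ≤ R(⟨k,m,p⟩)` the FLATTENING `pow_ten_le_tensorRankD_sesqui : n¹⁰ ≤ R₄(S_n)`
(the cut `{0,1} | {2,3}` of the weighted tetrahedron has `n³·n³·n²·n² = n¹⁰` EPR dimensions across it).
No `sorry`, no new axiom, no instance, no notation, no `Prop`-valued definition.
-/

noncomputable section

-- D-0017 nested layout `Summits/<Summit>/<Sub>/…` with `Sub = Summit` duplicates a namespace component.
set_option linter.dupNamespace false

open scoped BigOperators
open Filter Asymptotics Module
open Literature.Computability.AlgebraicComplexity
open Summit.MatrixMultiplication.MatrixMultiplication.Theorems.TetrahedronTensor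
open Summit.MatrixMultiplication.MatrixMultiplication.Theorems.ConeTensor

namespace Summit.MatrixMultiplication.MatrixMultiplication.Theorems.SesquiTensor

/-! ## The sesqui tensor `S_n = T(K₄)_n ⊠ W_n` and `T(K₄)_{n·n²} = ⟨n,n,n⟩_{rim} · S_n` -/

section Tensor

variable (F : Type*) [Field F]

/-- **The sesqui-weighted tetrahedron** `S_n = T(K₄)_n ⊠ W_n`: the graph tensor of `K₄` with spokes
`01,02,03` of size `n³ = n·n²` and rim edges `12,13,23` of size `n² = n·n`, in the cubic 4-leg format
of side `(n·n²)³` (leg index = three pair labels `Fin (n·n²) ≃ Fin n × Fin (n·n)`; first components,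
re-encoded by `K₁`, feed `T(K₄)_n`, second components, re-encoded by `K₂`, feed `W_n`; a rim leg
ignores the second half of the `W`-component of its two rim labels). (CVZ19, Ex. 1.1.2 and §1.1
(graph tensors multiply under `⊠`)). -/
def sesqui (n : ℕ) : (Fin 4 → Fin ((n * (n * n)) ^ 3)) → F := fun i =>
  tetra F n (fun v => K₁ (i v)) * cone F n (fun v => K₂ (i v))

variable {F}

/-- Unfolding `S_n(i) = T(K₄)_n(K₁ ∘ i) · W_n(K₂ ∘ i)`. [folklore] -/
theorem sesqui_apply {n : ℕ} (i : Fin 4 → Fin ((n * (n * n)) ^ 3)) :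
    sesqui F n i = tetra F n (fun v => K₁ (i v)) * cone F n (fun v => K₂ (i v)) := rfl

/-- **`T(K₄)_{n·n²} = ⟨n,n,n⟩_{123} · S_n`** pointwise: at level `n·n²` the tetrahedron is the rim
triangle (read off the second halves of the `W`-components of the rim labels) times the sesqui tensor
(`tetra_mul_apply` at `N = n`, `M = n·n`, then `tetra_sq_eq_rim_mul_cone`).
[cite: ChristandlVranaZuiddam2016, Prop. 1.1.26 (proof)] -/
theorem tetra_cube_eq_rim_mul_sesqui {n : ℕ} (i : Fin 4 → Fin ((n * (n * n)) ^ 3)) :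
    tetra F (n * (n * n)) i =
      matMulTensor F n n n (P₂ (K₂ (i 1)) 1, P₂ (K₂ (i 1)) 2) (P₂ (K₂ (i 2)) 1, P₂ (K₂ (i 2)) 2)
          (P₂ (K₂ (i 3)) 2, P₂ (K₂ (i 3)) 1) *
        sesqui F n i := by
  rw [tetra_mul_apply, tetra_sq_eq_rim_mul_cone]
  simp only [sesqui_apply]
  ring

/-! ## The Kronecker cover `R₄(S_n) ≤ R₄(T(K₄)_n) · R₄(W_n)` -/

/-- The legs of the product summand indexed by `k = (k₁, k₂)`: at every vertex, the level-`n`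
tetrahedron leg `k₁` on first components times the cone leg `k₂` on second components.
(CVZ19, Prop. 1.1.16 (proof)). -/
def kronLeg {n r₁ r₂ : ℕ} (u₁ : Fin r₁ → Fin 4 → Fin (n ^ 3) → F)
    (u₂ : Fin r₂ → Fin 4 → Fin ((n * n) ^ 3) → F) (k : Fin r₁ × Fin r₂) :
    Fin 4 → Fin ((n * (n * n)) ^ 3) → F :=
  fun v x => u₁ k.1 v (K₁ x) * u₂ k.2 v (K₂ x)

/-- **Rank-one decompositions multiply under `⊠`**: from `T(K₄)_n = ∑_{k₁} ⊗_v u₁(k₁,v)` and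
`W_n = ∑_{k₂} ⊗_v u₂(k₂,v)`, `S_n = ∑_{(k₁,k₂)} ⊗_v (u₁(k₁,v) ∘ K₁) · (u₂(k₂,v) ∘ K₂)`.
[cite: ChristandlVranaZuiddam2016, Prop. 1.1.16 (proof)] -/
theorem sesqui_eq_sum_kron {n r₁ r₂ : ℕ} {u₁ : Fin r₁ → Fin 4 → Fin (n ^ 3) → F}
    {u₂ : Fin r₂ → Fin 4 → Fin ((n * n) ^ 3) → F}
    (hu₁ : ∑ k, rankOneTensor (u₁ k) = tetra F n) (hu₂ : ∑ k, rankOneTensor (u₂ k) = cone F n) :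
    ∑ k, rankOneTensor (kronLeg u₁ u₂ k) = sesqui F n := by
  funext i
  rw [Finset.sum_apply, Fintype.sum_prod_type, sesqui_apply,
    ← congrFun hu₁ (fun v => K₁ (i v)), ← congrFun hu₂ (fun v => K₂ (i v)),
    Finset.sum_apply, Finset.sum_apply, Finset.sum_mul_sum]
  refine Finset.sum_congr rfl fun k₁ _ => Finset.sum_congr rfl fun k₂ _ => ?_
  simp only [rankOneTensor_apply, kronLeg, ← Finset.prod_mul_distrib]

/-- `S_n` decomposes over rank-one tensors (so `tensorRankD (sesqui F n)` is a genuine minimum).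
[cite: ChristandlVranaZuiddam2016, Ex. 1.1.2] -/
theorem sesqui_decomposable (n : ℕ) :
    ∃ s : ℕ, ∃ g : Fin s → ((Fin 4 → Fin ((n * (n * n)) ^ 3)) → F),
      (∀ k, g k ∈ rankOneTensors F ((n * (n * n)) ^ 3) 4) ∧ ∑ k, g k = sesqui F n := by
  classical
  obtain ⟨u₁, hu₁⟩ := exists_rankOne_decomposition_tetra (F := F) n
  obtain ⟨u₂, hu₂⟩ := exists_rankOne_decomposition_cone (F := F) n
  let e := Fintype.equivFin (Fin (tensorRankD (tetra F n)) × Fin (tensorRankD (cone F n)))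
  refine ⟨_, fun k => rankOneTensor (kronLeg u₁ u₂ (e.symm k)), fun _ => rankOneTensor_mem _, ?_⟩
  rw [← sesqui_eq_sum_kron hu₁ hu₂]
  exact Fintype.sum_equiv e.symm _ _ (fun _ => rfl)

/-- **Kronecker cover** `R₄(S_n) ≤ R₄(T(K₄)_n) · R₄(W_n)`. [cite: ChristandlVranaZuiddam2016, Prop. 1.1.16 (proof)] -/
theorem tensorRankD_sesqui_le (n : ℕ) :
    tensorRankD (sesqui F n) ≤ tensorRankD (tetra F n) * tensorRankD (cone F n) := by
  classical
  obtain ⟨u₁, hu₁⟩ := exists_rankOne_decomposition_tetra (F := F) n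
  obtain ⟨u₂, hu₂⟩ := exists_rankOne_decomposition_cone (F := F) n
  have hcard : Fintype.card (Fin (tensorRankD (tetra F n)) × Fin (tensorRankD (cone F n))) =
      tensorRankD (tetra F n) * tensorRankD (cone F n) := by simp
  rw [← hcard]
  let e := Fintype.equivFin (Fin (tensorRankD (tetra F n)) × Fin (tensorRankD (cone F n)))
  refine tensorRankD_le_of_eq_sum (fun k => kronLeg u₁ u₂ (e.symm k)) ?_
  rw [← sesqui_eq_sum_kron hu₁ hu₂]
  exact Fintype.sum_equiv e.symm _ _ (fun _ => rfl)

/-- **Trivial upper bound** `R₄(S_n) ≤ n¹⁵` (`R₄(T(K₄)_n) ≤ n⁶`, `R₄(W_n) ≤ n⁹`; = the number of edge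
labellings `(n³)³ · (n²)³`). [cite: ChristandlVranaZuiddam2016, §1.2 (table)] -/
theorem tensorRankD_sesqui_le_pow_fifteen (n : ℕ) : tensorRankD (sesqui F n) ≤ n ^ 15 :=
  calc tensorRankD (sesqui F n) ≤ tensorRankD (tetra F n) * tensorRankD (cone F n) :=
      tensorRankD_sesqui_le n
    _ ≤ n ^ 6 * n ^ 9 :=
      Nat.mul_le_mul (tensorRankD_tetra_le (F := F) n) (tensorRankD_cone_le_pow_nine (F := F) n)
    _ = n ^ 15 := by ring

/-- A rank-one decomposition of `S_n` of length exactly `R₄(S_n)`. [folklore] -/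
theorem exists_rankOne_decomposition_sesqui (n : ℕ) :
    ∃ u : Fin (tensorRankD (sesqui F n)) → Fin 4 → Fin ((n * (n * n)) ^ 3) → F,
      ∑ k, rankOneTensor (u k) = sesqui F n := by
  classical
  obtain ⟨g, hg, hs⟩ := sComplexity_spec (sesqui_decomposable (F := F) n)
  simp only [rankOneTensors, Set.mem_range] at hg
  choose u hu using hg
  have h : ∑ k, rankOneTensor (u k) = ∑ k, g k := Finset.sum_congr rfl fun k _ => hu k
  exact ⟨u, h.trans hs⟩

/-! ## The rim cover `R₄(T(K₄)_{n·n²}) ≤ R(⟨n,n,n⟩) · R₄(S_n)` -/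

/-- **`R₄(T(K₄)_{n·n²}) ≤ R(⟨n,n,n⟩) · R₄(S_n)`**: the products of a triad decomposition of the rim
triangle `⟨n,n,n⟩_{123}` with a rank-one decomposition of `S_n` decompose `T(K₄)_{n·n²}`
(pointwise `T(K₄)_{n·n²} = ⟨n,n,n⟩_{rim} · S_n`). [cite: ChristandlVranaZuiddam2016, Prop. 1.1.16 (proof)] -/
theorem tensorRankD_tetra_cube_le_mul_sesqui (n : ℕ) :
    tensorRankD (tetra F (n * (n * n))) ≤
      tensorRank (matMulTensor F n n n) * tensorRankD (sesqui F n) := by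
  classical
  obtain ⟨w, u, v, hdec⟩ := exists_triad_decomposition_tensorRank (matMulTensor F n n n)
  obtain ⟨u', hu'⟩ := exists_rankOne_decomposition_sesqui (F := F) n
  have hMM : ∀ a b c, matMulTensor F n n n a b c =
      ∑ j : Fin (tensorRank (matMulTensor F n n n)), w j a * u j b * v j c := by
    intro a b c
    have h := congrFun (congrFun (congrFun hdec a) b) c
    rw [h, Finset.sum_apply, Finset.sum_apply, Finset.sum_apply]
    rfl
  let L : Fin (tensorRank (matMulTensor F n n n)) × Fin (tensorRankD (sesqui F n)) →
      Fin 4 → Fin ((n * (n * n)) ^ 3) → F := fun p =>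
    ![fun x => u' p.2 0 x,
      fun x => w p.1 (P₂ (K₂ x) 1, P₂ (K₂ x) 2) * u' p.2 1 x,
      fun x => u p.1 (P₂ (K₂ x) 1, P₂ (K₂ x) 2) * u' p.2 2 x,
      fun x => v p.1 (P₂ (K₂ x) 2, P₂ (K₂ x) 1) * u' p.2 3 x]
  have hsum : ∑ p, rankOneTensor (L p) = tetra F (n * (n * n)) := by
    funext i
    rw [Finset.sum_apply, Fintype.sum_prod_type, tetra_cube_eq_rim_mul_sesqui, hMM,
      ← congrFun hu' i, Finset.sum_apply, Finset.sum_mul_sum]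
    refine Finset.sum_congr rfl fun j _ => Finset.sum_congr rfl fun k _ => ?_
    rw [rankOneTensor_apply, rankOneTensor_apply, Fin.prod_univ_four, Fin.prod_univ_four]
    simp only [L, Matrix.cons_val_zero, Matrix.cons_val_one, Matrix.cons_val_two,
      Matrix.cons_val_three, Matrix.head_cons, Matrix.tail_cons]
    ring
  have hcard : Fintype.card
      (Fin (tensorRank (matMulTensor F n n n)) × Fin (tensorRankD (sesqui F n))) =
      tensorRank (matMulTensor F n n n) * tensorRankD (sesqui F n) := by simp
  rw [← hcard]
  let e := Fintype.equivFin
    (Fin (tensorRank (matMulTensor F n n n)) × Fin (tensorRankD (sesqui F n)))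
  refine tensorRankD_le_of_eq_sum (fun k => L (e.symm k)) ?_
  rw [← hsum]
  exact Fintype.sum_equiv e.symm _ _ (fun _ => rfl)

end Tensor

/-! ## Grouping `{2,3} | 0 | 1`: `R(⟨n⁶, n⁴, n³⟩) ≤ R₄(S_n)` and the flattening `n¹⁰ ≤ R₄(S_n)` -/

section Grouping

variable {F : Type*} [Field F]

/-- Zip a level-`n` leg index and a level-`n·n` leg index (three labels each) into the level-`n·n²`
leg index with the paired labels. -/
def zipLeg {n : ℕ} (x : Fin (n ^ 3)) (y : Fin ((n * n) ^ 3)) : Fin ((n * (n * n)) ^ 3) :=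
  finFunctionFinEquiv fun j =>
    finProdFinEquiv (finFunctionFinEquiv.symm x j, finFunctionFinEquiv.symm y j)

/-- First components of a zipped leg index. [folklore] -/
@[simp] theorem K₁_zipLeg {n : ℕ} (x : Fin (n ^ 3)) (y : Fin ((n * n) ^ 3)) :
    K₁ (zipLeg x y) = x := by
  simp [K₁, zipLeg]

/-- Second components of a zipped leg index. [folklore] -/
@[simp] theorem K₂_zipLeg {n : ℕ} (x : Fin (n ^ 3)) (y : Fin ((n * n) ^ 3)) :
    K₂ (zipLeg x y) = y := by
  simp [K₂, zipLeg]

/-- First components of a point of `⟨q·q', ?, r·r'⟩`-type index pairs: `(X.1 mod, X.2 mod)` read through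
`finProdFinEquiv`. -/
def fst₂ {q q' r r' : ℕ} (X : Fin (q * q') × Fin (r * r')) : Fin q × Fin r :=
  ((finProdFinEquiv.symm X.1).1, (finProdFinEquiv.symm X.2).1)

/-- Second components of a point of paired indices. -/
def snd₂ {q q' r r' : ℕ} (X : Fin (q * q') × Fin (r * r')) : Fin q' × Fin r' :=
  ((finProdFinEquiv.symm X.1).2, (finProdFinEquiv.symm X.2).2)

/-- **Matrix multiplication tensors multiply under `⊠`**: on paired indices,
`⟨k,m,p⟩(first components) · ⟨k',m',p'⟩(second components) = ⟨k·k', m·m', p·p'⟩`.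
[cite: Blaser2013, §5 (the tensor ⟨k,m,n⟩)] -/
theorem matMulTensor_fst₂_mul_snd₂ {k m p k' m' p' : ℕ} (A : Fin (k * k') × Fin (p * p'))
    (B : Fin (k * k') × Fin (m * m')) (C : Fin (m * m') × Fin (p * p')) :
    matMulTensor F k m p (fst₂ A) (fst₂ B) (fst₂ C) *
        matMulTensor F k' m' p' (snd₂ A) (snd₂ B) (snd₂ C) =
      matMulTensor F (k * k') (m * m') (p * p') A B C := by
  have e : ∀ {q q' : ℕ} (x y : Fin (q * q')), x = y ↔
      ((finProdFinEquiv.symm x).1 = (finProdFinEquiv.symm y).1 ∧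
        (finProdFinEquiv.symm x).2 = (finProdFinEquiv.symm y).2) := fun x y => by
    rw [← Prod.ext_iff, Equiv.apply_eq_iff_eq]
  simp only [matMulTensor, ite_one_zero_mul_ite, fst₂, snd₂]
  refine if_congr ?_ rfl rfl
  rw [e A.1 B.1, e B.2 C.1, e A.2 C.2]
  tauto

/-- The vertex label triples of `T(K₄)_N` read off a point `(a, b, c)` of `⟨N², N², N⟩` under the
grouping `{2,3} | 0 | 1` (`a = (κ, ν)`, `b = (κ', μ')`, `c = (μ, ν')`; spokes `(e₀₂, e₀₃) = κ` resp.
`κ'`, rim edges `(e₁₂, e₁₃) = μ` resp. `μ'`, spoke `e₀₁ = ν` resp. `ν'`, rim edge `e₂₃` frozen to `0`). -/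
def tLabels {N : ℕ} [NeZero N] (a : Fin (N * N) × Fin N) (b : Fin (N * N) × Fin (N * N))
    (c : Fin (N * N) × Fin N) : Fin 4 → Fin 3 → Fin N :=
  ![![a.2, (finProdFinEquiv.symm a.1).1, (finProdFinEquiv.symm a.1).2],
    ![c.2, (finProdFinEquiv.symm c.1).1, (finProdFinEquiv.symm c.1).2],
    ![(finProdFinEquiv.symm b.1).1, (finProdFinEquiv.symm b.2).1, 0],
    ![(finProdFinEquiv.symm b.1).2, (finProdFinEquiv.symm b.2).2, 0]]

/-- **The tetrahedron grouped `{2,3} | 0 | 1` is `⟨N², N², N⟩`**: at the leg indices encoded by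
`tLabels a b c`, `T(K₄)_N` takes the value `⟨N², N², N⟩(a, b, c)`. [folklore] -/
theorem tetra_tLabels {N : ℕ} [NeZero N] (a : Fin (N * N) × Fin N) (b : Fin (N * N) × Fin (N * N))
    (c : Fin (N * N) × Fin N) :
    tetra F N (fun v => enc (tLabels a b c v 0) (tLabels a b c v 1) (tLabels a b c v 2)) =
      matMulTensor F (N * N) (N * N) N a b c := by
  have e : ∀ x y : Fin (N * N), x = y ↔
      ((finProdFinEquiv.symm x).1 = (finProdFinEquiv.symm y).1 ∧
        (finProdFinEquiv.symm x).2 = (finProdFinEquiv.symm y).2) := fun x y => by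
    rw [← Prod.ext_iff, Equiv.apply_eq_iff_eq]
  rw [tetra_apply_enc]
  simp only [matMulTensor]
  refine if_congr ?_ rfl rfl
  simp only [consistent_iff, tLabels, Matrix.cons_val_zero, Matrix.cons_val_one,
    Matrix.cons_val_two, Matrix.cons_val_three, Matrix.head_cons, Matrix.tail_cons, e a.1 b.1,
    e b.2 c.1, and_true, @eq_comm _ (finProdFinEquiv.symm c.1).1 (finProdFinEquiv.symm b.2).1,
    @eq_comm _ (finProdFinEquiv.symm c.1).2 (finProdFinEquiv.symm b.2).2]
  tauto

variable {n : ℕ} [NeZero n]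

/-- Leg of the apex `0` off the point `A` of `⟨n²·n⁴, n²·n², n·n²⟩` (first components: the level-`n`
tetrahedron labels `(e₀₁, e₀₂, e₀₃)`; second components: the cone leg `leg₀`). -/
def sleg₀ (A : Fin (n * n * (n * n * (n * n))) × Fin (n * (n * n))) : Fin ((n * (n * n)) ^ 3) :=
  zipLeg (enc (fst₂ A).2 (finProdFinEquiv.symm (fst₂ A).1).1 (finProdFinEquiv.symm (fst₂ A).1).2)
    (leg₀ (snd₂ A))

/-- Leg of vertex `1` off the point `C`. -/
def sleg₁ (C : Fin (n * n * (n * n)) × Fin (n * (n * n))) : Fin ((n * (n * n)) ^ 3) :=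
  zipLeg (enc (fst₂ C).2 (finProdFinEquiv.symm (fst₂ C).1).1 (finProdFinEquiv.symm (fst₂ C).1).2)
    (leg₁ (snd₂ C))

/-- Leg of vertex `2` off the point `B` (rim edge `23` frozen to `0`). -/
def sleg₂ (B : Fin (n * n * (n * n * (n * n))) × Fin (n * n * (n * n))) :
    Fin ((n * (n * n)) ^ 3) :=
  zipLeg (enc (finProdFinEquiv.symm (fst₂ B).1).1 (finProdFinEquiv.symm (fst₂ B).2).1 0)
    (leg₂ (snd₂ B))

/-- Leg of vertex `3` off the point `B` (rim edge `23` frozen to `0`). -/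
def sleg₃ (B : Fin (n * n * (n * n * (n * n))) × Fin (n * n * (n * n))) :
    Fin ((n * (n * n)) ^ 3) :=
  zipLeg (enc (finProdFinEquiv.symm (fst₂ B).1).2 (finProdFinEquiv.symm (fst₂ B).2).2 0)
    (leg₃ (snd₂ B))

/-- The four legs of `S_n` read off a point `(A, B, C)` of `⟨n²·n⁴, n²·n², n·n²⟩` under the grouping
`{2,3} | 0 | 1`. -/
def spoint (A : Fin (n * n * (n * n * (n * n))) × Fin (n * (n * n)))
    (B : Fin (n * n * (n * n * (n * n))) × Fin (n * n * (n * n)))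
    (C : Fin (n * n * (n * n)) × Fin (n * (n * n))) : Fin 4 → Fin ((n * (n * n)) ^ 3) :=
  ![sleg₀ A, sleg₁ C, sleg₂ B, sleg₃ B]

/-- **The grouped sesqui tensor is `⟨n⁶, n⁴, n³⟩`** (as `⟨n²·n⁴, n²·n², n·n²⟩`): at the legs
`spoint A B C`, `S_n` takes the value `⟨n²·n⁴, n²·n², n·n²⟩(A, B, C)` — the tetrahedron factor is
`⟨n²,n²,n⟩` on first components (`tetra_tLabels`), the cone factor `⟨n⁴,n²,n²⟩` on second components
(`cone_groupLegs`), and matrix multiplication tensors multiply under `⊠`. [folklore] -/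
theorem sesqui_spoint (A : Fin (n * n * (n * n * (n * n))) × Fin (n * (n * n)))
    (B : Fin (n * n * (n * n * (n * n))) × Fin (n * n * (n * n)))
    (C : Fin (n * n * (n * n)) × Fin (n * (n * n))) :
    sesqui F n (spoint A B C) =
      matMulTensor F (n * n * (n * n * (n * n))) (n * n * (n * n)) (n * (n * n)) A B C := by
  have h1 : (fun v => K₁ (spoint A B C v)) = fun v =>
      enc (tLabels (fst₂ A) (fst₂ B) (fst₂ C) v 0) (tLabels (fst₂ A) (fst₂ B) (fst₂ C) v 1)
        (tLabels (fst₂ A) (fst₂ B) (fst₂ C) v 2) := by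
    funext v
    fin_cases v <;> simp [spoint, sleg₀, sleg₁, sleg₂, sleg₃, tLabels]
  have h2 : (fun v => K₂ (spoint A B C v)) = groupLegs (snd₂ A) (snd₂ B) (snd₂ C) := by
    funext v
    fin_cases v <;> simp [spoint, sleg₀, sleg₁, sleg₂, sleg₃, groupLegs]
  rw [sesqui_apply, h1, h2, tetra_tLabels, cone_groupLegs, matMulTensor_fst₂_mul_snd₂]

/-- **Grouping lower-bound transfer** `R(⟨n²·n⁴, n²·n², n·n²⟩) ≤ R₄(S_n)` (`n ≥ 1`): a rank-one
decomposition `S_n = ∑_k ⊗_v u_k(v)` restricts along `spoint` to the triad decomposition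
`⟨n⁶,n⁴,n³⟩ = ∑_k u_k(0) ∘ sleg₀ ⊗ (u_k(2) ∘ sleg₂ · u_k(3) ∘ sleg₃) ⊗ u_k(1) ∘ sleg₁`. [folklore] -/
theorem tensorRank_matMulTensor_le_tensorRankD_sesqui (n : ℕ) [NeZero n] :
    tensorRank (matMulTensor F (n * n * (n * n * (n * n))) (n * n * (n * n)) (n * (n * n))) ≤
      tensorRankD (sesqui F n) := by
  classical
  obtain ⟨u, hu⟩ := exists_rankOne_decomposition_sesqui (F := F) n
  refine tensorRank_le_of_eq_sum (fun k A => u k 0 (sleg₀ A))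
    (fun k B => u k 2 (sleg₂ B) * u k 3 (sleg₃ B)) (fun k C => u k 1 (sleg₁ C)) ?_
  funext A B C
  have hpt := congrFun hu (spoint A B C)
  rw [Finset.sum_apply, sesqui_spoint] at hpt
  rw [← hpt, Finset.sum_apply, Finset.sum_apply, Finset.sum_apply]
  refine Finset.sum_congr rfl fun k _ => ?_
  rw [rankOneTensor_apply, Fin.prod_univ_four, triad_apply]
  simp only [spoint, Matrix.cons_val_zero, Matrix.cons_val_one, Matrix.cons_val_two,
    Matrix.cons_val_three, Matrix.head_cons, Matrix.tail_cons]
  ring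

/-- **Flattening lower bound** `n¹⁰ ≤ R₄(S_n)` for `n ≥ 1` (the cut `{0,1} | {2,3}` of the weighted
tetrahedron crosses the spokes `02, 03` (`n³` each) and the rim edges `12, 13` (`n²` each); here:
grouping + the flattening `k·m ≤ R(⟨k,m,p⟩)` of `⟨n⁶,n⁴,n³⟩`). [cite: ChristandlVranaZuiddam2016, §1.2 (eq. (flat))] -/
theorem pow_ten_le_tensorRankD_sesqui (n : ℕ) [NeZero n] : n ^ 10 ≤ tensorRankD (sesqui F n) := by
  haveI : NeZero (n * (n * n)) :=
    ⟨mul_ne_zero (NeZero.ne n) (mul_ne_zero (NeZero.ne n) (NeZero.ne n))⟩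
  calc n ^ 10 = n * n * (n * n * (n * n)) * (n * n * (n * n)) := by ring
    _ ≤ tensorRank (matMulTensor F (n * n * (n * n * (n * n))) (n * n * (n * n)) (n * (n * n))) :=
        mul_le_tensorRank_matMulTensor_left F _ _ _
    _ ≤ tensorRankD (sesqui F n) := tensorRank_matMulTensor_le_tensorRankD_sesqui n

/-- The flattening bound for all `n` (trivial at `n = 0`). [cite: ChristandlVranaZuiddam2016, §1.2 (eq. (flat))] -/
theorem pow_ten_le_tensorRankD_sesqui' (n : ℕ) : n ^ 10 ≤ tensorRankD (sesqui F n) := by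
  rcases Nat.eq_zero_or_pos n with rfl | hn
  · simp
  · haveI : NeZero n := ⟨hn.ne'⟩
    exact pow_ten_le_tensorRankD_sesqui n

end Grouping

end Summit.MatrixMultiplication.MatrixMultiplication.Theorems.SesquiTensor

end
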